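import Literature.NumberTheory.Rogawski1990.UnitOrbitalIntegralInertClosedForms          -- ★ `phiH` (type (1) torus, both H-classes)
import Literature.NumberTheory.Rogawski1990.UnitOrbitalIntegralInertClosedFormsTypeTwo   -- ★ `phiHtwo` (type (2) torus)
import HarnessLib

/-!
# The identity-germ combination of the `H`-side unit closed forms (road «S3-tree», T6 ∕ ruling A-51; Rogawski 1990 §8.1 (8.1.1)–(8.1.2))

Topic `NumberTheory/Rogawski1990`; namespace `Literature.NumberTheory.Rogawski1990.Flicker1998`.  THEOREMS ONLY (no definition, no instance, no notation, no named
fact, no `sorry`).  Cell `pub/hodgecm-mathlib` (D-0151), crux H413 = `stmt-HodgeConjecture-24833`, road «S3-tree» (census «S3» v3 0ca147ac, architect A-p16), written by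
F0P3-p01 (g16) (S3-T0 co-reader).  HONEST LABEL: HC_CM is proved only modulo the printed citations (the 2 remaining named inputs hLiu418, h413) until rung 0 closes;
this file is pure arithmetic on the tree's printed closed forms and asserts nothing about orbital integrals.

THE POINT (S3-T0 T4′ report 98b014df, law for the `K′`-unit; co-reader's advice on A-51).  On `H_v = U(1,1) × U(1)` at an inert place the stable orbital integral of
`1_{K_H}` along a regular `γ_H` of depth `N` is ★ `phiH q N = (q^N(q+1) − 2)∕(q−1)` on the torus `(E¹)³` (both `H`-classes), ★ `phiHtwo q N = (q^{N+1} − 1)∕(q−1)` on a type-(2)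
torus `T_K × E¹`, and `q^N` on the split torus (mod the translation).  By the depth-shift law C1 the stable orbital integral of the LEVEL-ONE unit `1_{K_H(1)}` is the same
closed form at depth `N − 1`.  The combination `Φ^{st}_H(γ, 1_{K_H}) − q·Φ^{st}_H(γ, 1_{K_H(1)})` is therefore
**`phiH q (N+1) − q·phiH q N = 2`, `phiHtwo q (N+1) − q·phiHtwo q N = 1`, `q^{N+1} − q·q^N = 0`** — INDEPENDENT OF THE DEPTH, with values
`(2, 1, 0) = |𝔇_H(T)| · [T elliptic]` on the three torus types: the STABLE IDENTITY GERM of `H` ([Rogawski1990] (8.1.1)–(8.1.2): the constant term of the germ expansion is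
`d · Σ_{j ∈ 𝔇(T)} (−1)^{q(I(j))}` on an elliptic torus and vanishes on the split one).  It is the natural third basis vector of T6's depth-zero realisability table and, by the
co-reader's certificate rows, exactly the correction in the transfer of the `K′`-unit: `Δ·Φ^κ(·,1_{K′}) = Φ^{st}_H(·,1_{K_H}) − [this] = q·Φ^{st}_H(·,1_{K_H(1)})`.

* `phiH_succ_sub_mul` : `phiH q (N + 1) − q * phiH q N = 2`   (`q ≠ 1`);
* `phiHtwo_succ_sub_mul` : `phiHtwo q (N + 1) − q * phiHtwo q N = 1`   (`q ≠ 1`);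
* `pow_succ_sub_mul_pow` : `q^(N+1) − q * q^N = 0` (the split torus row, recorded for the table);
* `phiH_succ_sub_mul_eq_two_mul_phiHtwo_succ_sub_mul` : the type-(1) value is twice the type-(2) value (`|𝔇_H| = 2` vs `1`).

## References
* [Rogawski1990] J. D. Rogawski, *Automorphic Representations of Unitary Groups in Three Variables*, Ann. of Math. Stud. 123 (1990), §8.1 Prop. 8.1.3 and (8.1.1)–(8.1.2)
  pp. 110–111 (the constant term of the germ expansion: `d Σ_j (−1)^{q(I(j))} κ(inv) Φ(j(γ), f)`), §3.6 Lemma 3.6.1 p. 27 (`𝓔_H(T) ↪ 𝓔_G(T)` of index two).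
* [Flicker1998UnitaryFL] Y. Z. Flicker, *Elementary proof of the fundamental lemma for a unitary group*, Canad. J. Math. 50 (1998), §6 p. 95 (`Φ^{st}_{1_{K_H}} =
  (q^N(q+1) − 2)∕(q−1)`), p. 97 (`(q^{N+1} − 1)∕(q−1)` on `T_L`).
-/

set_option autoImplicit false

namespace Literature.NumberTheory.Rogawski1990.Flicker1998

/-- **The identity-germ combination on the torus `(E¹)³ ⊂ H`**: `phiH q (N+1) − q·phiH q N = 2` for `q ≠ 1` — the depth-independent value `|𝔇_H(T)| = 2`.
[cite: Rogawski1990, §8.1 (8.1.1)–(8.1.2) pp. 110–111] [cite: Flicker1998UnitaryFL, §6 p. 95] -/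
theorem phiH_succ_sub_mul {q : ℕ} (hq : q ≠ 1) (N : ℕ) : phiH q (N + 1) - (q : ℚ) * phiH q N = 2 := by
  have h1 : (q : ℚ) - 1 ≠ 0 := by
    rw [sub_ne_zero]
    exact_mod_cast hq
  rw [phiH, phiH, pow_succ]
  field_simp
  ring

/-- **The identity-germ combination on a type-(2) torus `T_K × E¹ ⊂ H`**: `phiHtwo q (N+1) − q·phiHtwo q N = 1` for `q ≠ 1` — the value `|𝔇_H(T)| = 1`.
[cite: Rogawski1990, §8.1 (8.1.1)–(8.1.2) pp. 110–111] [cite: Flicker1998UnitaryFL, p. 97] -/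
theorem phiHtwo_succ_sub_mul {q : ℕ} (hq : q ≠ 1) (N : ℕ) : phiHtwo q (N + 1) - (q : ℚ) * phiHtwo q N = 1 := by
  have h1 : (q : ℚ) - 1 ≠ 0 := by
    rw [sub_ne_zero]
    exact_mod_cast hq
  rw [phiHtwo, phiHtwo, pow_succ, pow_succ]
  field_simp
  ring

/-- **The split torus row**: the level-unit counts are `q^N` (fixed hyperspecial vertices modulo the translation), and `q^{N+1} − q·q^N = 0` — the identity germ
vanishes off the elliptic tori. [cite: Rogawski1990, §8.1 (8.1.1)–(8.1.2) pp. 110–111] -/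
theorem pow_succ_sub_mul_pow (q : ℚ) (N : ℕ) : q ^ (N + 1) - q * q ^ N = 0 := by
  rw [pow_succ, mul_comm, sub_self]

/-- **The three values are `(2, 1, 0) = |𝔇_H(T)|·[T elliptic]`**: the type-(1) value is twice the type-(2) value, uniformly in `q ≠ 1` and the depth.
[cite: Rogawski1990, §3.6 Lemma 3.6.1 p. 27; §8.1 (8.1.2) p. 111] -/
theorem phiH_succ_sub_mul_eq_two_mul_phiHtwo_succ_sub_mul {q : ℕ} (hq : q ≠ 1) (N M : ℕ) :
    phiH q (N + 1) - (q : ℚ) * phiH q N = 2 * (phiHtwo q (M + 1) - (q : ℚ) * phiHtwo q M) := by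
  rw [phiH_succ_sub_mul hq, phiHtwo_succ_sub_mul hq]
  norm_num

end Literature.NumberTheory.Rogawski1990.Flicker1998
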